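import Summits.BirchSwinnertonDyer.Rank1Residual.GaloisImage.ThreeAdicTowerInertiaCriterion
import Summits.BirchSwinnertonDyer.Rank1Residual.GaloisImage.ThreeTorsionInertiaTame
import HarnessLib

/-!
# The `3`-adic tower from two torsion valuations: a `9`-torsion abscissa of valuation with
# denominator divisible by `9` and a `3`-torsion abscissa of valuation with denominator divisible
# by `4` (cell `b2b-bsdres`, team n1011, row T-b9 'tame tower at `3`' — CASE-B socket, seat p02)

HONEST FRAMING (cell `b2b-bsdres`, run/shared/lean/b2b/bsd-rank1-residual/, verbatim in every
file): the goal of the cell is to DELETE the COMBINATION-SHAPED residual classes of the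
Birch–Swinnerton-Dyer formula for ALL analytic-rank `≤ 1` elliptic curves over `ℚ` — "full BSD
formula for every rank `≤ 1` curve in class `C`" assembled STRICTLY from published theorems — so
that the rank-`≤ 1` remainder becomes exactly the CONSTRUCTION-SHAPED classes, which are TYPED
(missing-input `Prop`s), NOT attempted. This is not "finishing BSD". Research route; theorems
only (no definition, no named fact); nothing is booked by this file; no label changes.

## What this file proves (assembly of `ThreeAdicTowerInertiaCriterion.lean` §4 with
`ThreeTorsionInertiaTame.lean`)

For an elliptic curve `E = W/ℚ` (any Weierstrass model) with `ρ̄_{E,3}` onto, `v` the place of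
`ℚ̄` over `3`:

* `forall_hasSurjectiveModNGaloisRep_three_pow_of_surj_of_valuation_X_pow_eq_of_four_dvd` — with
  the place data `(v, 𝔓)` explicit: a `9`-torsion abscissa `x` with `v(x)^d = v(3)^b`, `d`
  coprime to `b`, `9 ∣ d`, and `4 ∣ #ρ̄_{E,3}(I_𝔓)` ⟹ `ρ̄_{E,3ⁿ}` onto for all `n`;
* `forall_hasSurjectiveModNGaloisRep_three_pow_of_surj_of_two_valuations` — NO place data: a
  `9`-torsion abscissa `x` with `v(x)^d = v(3)^b` (`d ⊥ b`, `9 ∣ d`) and a `3`-torsion abscissa `ξ`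
  with `v(ξ)^{d'} = v(3)^{b'}` (`d' ⊥ b'`, `4 ∣ d'`) ⟹ the tower; and the Kato (12.5.2) form.
  Row T-b9, Kodaira III case B: `(d, b, d', b') = (36, 17, 4, 1)`; III* case B′: `(36, 53, 4, 5)`.

References: [SerreAbelianLadic1968] IV-23 Lemma 3; [SerreLocalFields1979] Ch. IV §2; [Serre1972]
§4.1; [Kato2004Asterisque] (12.5.2) p. 222.
-/

noncomputable section

open scoped Classical NumberField Pointwise
open Field IsDedekindDomain WeierstrassCurve

namespace Summit.BirchSwinnertonDyer.Rank1Residual.GaloisImage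

open Literature.NumberTheory.EllipticCurves Literature.NumberTheory.GaloisRepresentations
  Rat.HeightOneSpectrum

section TameTower

variable (W : WeierstrassCurve ℚ) [W.IsElliptic]

/-- **CASE-B SOCKET with explicit place data**: `ρ̄_{E,3}` onto, `Q = (x, y) ∈ E[9]` with
`v(x)^d = v(3)^b`, `d` coprime to `b`, `9 ∣ d`, and `4 ∣ #ρ̄_{E,3}(I_𝔓)` ⟹ `ρ̄_{E,3ⁿ}` onto for
every `n` (`4 ∣ e₃ ⟹ 3 ∤ e₃`, then `…_of_valuation_X_pow_eq_of_not_three_dvd`).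
[cite: SerreAbelianLadic1968, Ch. IV §3.4, Lemma 3 (IV-23)] [cite: SerreLocalFields1979, Ch. IV §2 Cor. 1] -/
theorem forall_hasSurjectiveModNGaloisRep_three_pow_of_surj_of_valuation_X_pow_eq_of_four_dvd
    (hsurj : W.HasSurjectiveModNGaloisRep 3)
    {v : HeightOneSpectrum (𝓞 ℚ)} (hv : (primesEquiv v : ℕ) = 3)
    {𝔓 : Ideal (absIntegers (𝓞 ℚ) ℚ)}
    (hmem : ∀ x : absIntegers (𝓞 ℚ) ℚ, x ∈ 𝔓 ↔ (x : AlgebraicClosure ℚ) ∈ (placeOver 3).nonunits)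
    (h𝔓 : 𝔓 ∈ v.primesAbove)
    (h4 : 4 ∣ Nat.card ((𝔓.inertia (absoluteGaloisGroup ℚ)).map (galoisRepTorsion W 3)))
    {Q : W.geomPoints} (hQ : Q ∈ geomTorsion W 9) {x y : AlgebraicClosure ℚ}
    {h : (W.map (algebraMap ℚ (AlgebraicClosure ℚ))).toAffine.Nonsingular x y}
    (hQxy : Q = .some (x := x) (y := y) h) (hx0 : x ≠ 0) {d b : ℕ}
    (hval : (placeOver 3).valuation x ^ d = (placeOver 3).valuation 3 ^ b)
    (hcop : Nat.Coprime d b) (h9 : 9 ∣ d) (n : ℕ) :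
    W.HasSurjectiveModNGaloisRep (3 ^ n : ℕ) :=
  forall_hasSurjectiveModNGaloisRep_three_pow_of_surj_of_valuation_X_pow_eq_of_not_three_dvd W
    hsurj hv hmem h𝔓 (not_three_dvd_card_inertia_map_galoisRepTorsion_three_of_four_dvd hv h𝔓 h4)
    hQ hQxy hx0 hval hcop h9 n

/-- **THE TWO-VALUATION SOCKET (no place data, no reduction hypothesis).**  If `ρ̄_{E,3}` is onto,
some `Q = (x, y) ∈ E[9]` has `v(x)^d = v(3)^b` with `d` coprime to `b` and `9 ∣ d`, and some
`P = (ξ, η) ∈ E[3]` has `v(ξ)^{d'} = v(3)^{b'}` with `d'` coprime to `b'` and `4 ∣ d'` (`v` the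
place of `ℚ̄` over `3`), then `ρ̄_{E,3ⁿ}` is onto for every `n`.  (At the prime `𝔓` of the place:
`d ∣ e₉`, `d' ∣ e₃`, so `9 ∣ e₉` and `4 ∣ e₃ ⟹ 3 ∤ e₃`, whence a non-scalar first-order inertia
element and Serre's lifting lemma.)  Row T-b9: Kodaira III case B `(36, 17, 4, 1)`, III* case B′
`(36, 53, 4, 5)`. [cite: SerreAbelianLadic1968, Ch. IV §3.4, Lemma 3 (IV-23)]
[cite: SerreLocalFields1979, Ch. IV §2 Cor. 1] -/
theorem forall_hasSurjectiveModNGaloisRep_three_pow_of_surj_of_two_valuations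
    (hsurj : W.HasSurjectiveModNGaloisRep 3)
    {Q : W.geomPoints} (hQ : Q ∈ geomTorsion W 9) {x y : AlgebraicClosure ℚ}
    {h : (W.map (algebraMap ℚ (AlgebraicClosure ℚ))).toAffine.Nonsingular x y}
    (hQxy : Q = .some (x := x) (y := y) h) (hx0 : x ≠ 0) {d b : ℕ}
    (hval : (placeOver 3).valuation x ^ d = (placeOver 3).valuation 3 ^ b)
    (hcop : Nat.Coprime d b) (h9 : 9 ∣ d)
    {P : W.geomPoints} (hP : P ∈ geomTorsion W 3) {ξ η : AlgebraicClosure ℚ}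
    {h' : (W.map (algebraMap ℚ (AlgebraicClosure ℚ))).toAffine.Nonsingular ξ η}
    (hPξη : P = .some (x := ξ) (y := η) h') (hξ0 : ξ ≠ 0) {d' b' : ℕ}
    (hval' : (placeOver 3).valuation ξ ^ d' = (placeOver 3).valuation 3 ^ b')
    (hcop' : Nat.Coprime d' b') (h4 : 4 ∣ d') (n : ℕ) :
    W.HasSurjectiveModNGaloisRep (3 ^ n : ℕ) := by
  haveI : Fact (Nat.Prime 3) := ⟨Nat.prime_three⟩
  haveI : NeZero (3 : ℕ) := ⟨by norm_num⟩
  obtain ⟨v, hv⟩ : ∃ v : HeightOneSpectrum (𝓞 ℚ), (primesEquiv v : ℕ) = 3 :=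
    ⟨primesEquiv.symm ⟨3, Nat.prime_three⟩, by rw [Equiv.apply_symm_apply]⟩
  obtain ⟨𝔓, hmem, h𝔓⟩ := exists_ideal_placeOver 3 hv
  have hP' : P ∈ geomTorsion W ((3 : ℕ) : ℤ) := by exact_mod_cast hP
  have hd' : d' ∣ Nat.card ((𝔓.inertia (absoluteGaloisGroup ℚ)).map (galoisRepTorsion W 3)) := by
    exact_mod_cast dvd_card_inertia_map_galoisRepTorsion_of_valuation_X_pow_eq (W := W) (n := 3) hv
      hmem h𝔓 hP' hPξη hξ0 hval' hcop'
  exact forall_hasSurjectiveModNGaloisRep_three_pow_of_surj_of_valuation_X_pow_eq_of_four_dvd W hsurj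
    hv hmem h𝔓 (h4.trans hd') hQ hQxy hx0 hval hcop h9 n

/-- **Kato's (12.5.2) at `3` from the two torsion valuations** (same hypotheses):
`Kato2004.ImageContainsSL2 W 3`. [cite: Kato2004Asterisque, (12.5.2) (p. 222)]
[cite: SerreAbelianLadic1968, Ch. IV §3.4, Lemma 3 (IV-23)] -/
theorem imageContainsSL2_three_of_surj_of_two_valuations
    (hsurj : W.HasSurjectiveModNGaloisRep 3)
    {Q : W.geomPoints} (hQ : Q ∈ geomTorsion W 9) {x y : AlgebraicClosure ℚ}
    {h : (W.map (algebraMap ℚ (AlgebraicClosure ℚ))).toAffine.Nonsingular x y}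
    (hQxy : Q = .some (x := x) (y := y) h) (hx0 : x ≠ 0) {d b : ℕ}
    (hval : (placeOver 3).valuation x ^ d = (placeOver 3).valuation 3 ^ b)
    (hcop : Nat.Coprime d b) (h9 : 9 ∣ d)
    {P : W.geomPoints} (hP : P ∈ geomTorsion W 3) {ξ η : AlgebraicClosure ℚ}
    {h' : (W.map (algebraMap ℚ (AlgebraicClosure ℚ))).toAffine.Nonsingular ξ η}
    (hPξη : P = .some (x := ξ) (y := η) h') (hξ0 : ξ ≠ 0) {d' b' : ℕ}
    (hval' : (placeOver 3).valuation ξ ^ d' = (placeOver 3).valuation 3 ^ b')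
    (hcop' : Nat.Coprime d' b') (h4 : 4 ∣ d') :
    Kato2004.ImageContainsSL2 W 3 := by
  haveI : Fact (Nat.Prime 3) := ⟨Nat.prime_three⟩
  exact (Kato2004.imageContainsSL2_iff_forall_hasSurjectiveModNGaloisRep W 3).mpr
    (forall_hasSurjectiveModNGaloisRep_three_pow_of_surj_of_two_valuations W hsurj hQ hQxy hx0 hval
      hcop h9 hP hPξη hξ0 hval' hcop' h4)

end TameTower

end Summit.BirchSwinnertonDyer.Rank1Residual.GaloisImage

end
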